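import Mathlib
import Summits.Ventures.PercRepro2.Defs
import Summits.Ventures.PercRepro2.Graph
import Summits.Ventures.PercRepro2.OneColourSwitch
import Summits.Ventures.PercRepro2.RegionHubSign
import Summits.Ventures.PercRepro2.SideSwitch
import Summits.Ventures.PercRepro2.SideSwitchClosed
import Summits.Ventures.PercRepro2.M9NoPocketDefs
import Summits.Ventures.PercRepro2.M9NoPocketWorld
import Summits.Ventures.PercRepro2.M9NoPocketWorldD
import Summits.Ventures.PercRepro2.M9NoPocketFibre
import Summits.Ventures.PercRepro2.M9SubcubeHarris
import Summits.Ventures.PercRepro2.M9ClusterFibreHarris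
import Summits.Ventures.PercRepro2.M9PocketUnitFibre
import Summits.Ventures.PercRepro2.M9PocketUnitFibreSum

/-!
# The product fibre of a skeleton: the points (blind cell PercRepro2, p3 g39, 2026-08-29;
`proofs/P3-POCKETRK.md` §8′ (ii)–(iv) and §10 (d): the free-block extension, part 1)

A SKELETON `ρ` is a `K`-only legal point with no `W`-side in `G − d` (every block on the
`Y`-side).  Its switchable blocks `𝔉` are free blocks (no edge to `d`) not attached to the
pocket cluster `C_Y(d; ρ)`, closed in the sided set of `G − d`, inside the `Y`-world; its free
edges `R` are the edges not touching `U = C_Y(d) ∪ K₂(G − d) ∪ M₂(G − d)`.  The PRODUCT FIBRE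
is indexed by `S : Finset ({C // C ∈ 𝔉} ⊕ {e // e ∈ R})`: the point `φ S` has the blocks of
`S` switched to the `W`-side (every edge touching them in `G − d` flipped) and the free edges
of `S` open, the other free edges closed, everything else as in `ρ`.

This file: the edge values of `φ S` (`prod_eq_of_mem_R`, `prod_eq_of_touches`,
`prod_eq_fixed`), the base point is in the exploration fibre of `ρ` (`base_eqOn_U`), and the
worlds of `{r, s}` in `G − d` at `φ S` (`K2_endsD_prod`, `M2_endsD_prod`: the side switch of
the closed set of switched vertices).  Part 2 (`M9PocketProdWorlds`): the worlds of `{r, s}`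
in `G` at `φ S` and the legality of every point of the fibre.  Own work; std axioms.
-/

namespace Summit.Ventures.PercRepro2

namespace NoPocket

open Finset Classical OneColourSwitch SideSwitch

variable {V : Type*} {E : Type*} {ends : E → Sym2 V} {p q r s d : V} {ρ : Config E}
  {𝔉 : Finset (Finset V)} {R : Finset E}

section EdgeValues

/-- The switched vertices of `S` lie in the `Y`-world of `G − d` at `ρ`. -/
lemma switched_subset_K2 (h𝔉K : ∀ C ∈ 𝔉, (↑C : Set V) ⊆ K2 (endsD ends d) r s ρ)
    (S : Finset ({C // C ∈ 𝔉} ⊕ {e // e ∈ R})) :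
    {x : V | ∃ c : {C // C ∈ 𝔉}, Sum.inl c ∈ S ∧ x ∈ c.1} ⊆ K2 (endsD ends d) r s ρ := by
  rintro x ⟨c, _, hx⟩
  exact h𝔉K c.1 c.2 (Finset.mem_coe.2 hx)

/-- The switched vertices form a set closed in the sided set of `G − d`. -/
lemma closedIn_switched
    (h𝔉cl : ∀ C ∈ 𝔉, ClosedIn (endsD ends d) (sided (endsD ends d) r s ρ) (↑C : Set V))
    (S : Finset ({C // C ∈ 𝔉} ⊕ {e // e ∈ R})) :
    ClosedIn (endsD ends d) (sided (endsD ends d) r s ρ)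
      {x : V | ∃ c : {C // C ∈ 𝔉}, Sum.inl c ∈ S ∧ x ∈ c.1} := by
  rintro e x y hxy ⟨c, hc, hx⟩ hy
  exact ⟨c, hc, Finset.mem_coe.1 (h𝔉cl c.1 c.2 e x y hxy (Finset.mem_coe.2 hx) hy)⟩

/-- The value of `φ S` on a free edge. -/
lemma prod_eq_of_mem_R (S : Finset ({C // C ∈ 𝔉} ⊕ {e // e ∈ R})) {e : E} (he : e ∈ R)
    (hnt : e ∉ touches (endsD ends d) {x : V | ∃ c : {C // C ∈ 𝔉}, Sum.inl c ∈ S ∧ x ∈ c.1}) :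
    flipTouch (endsD ends d) {x : V | ∃ c : {C // C ∈ 𝔉}, Sum.inl c ∈ S ∧ x ∈ c.1}
      (fun e => if h : e ∈ R then decide (Sum.inr ⟨e, h⟩ ∈ S) else ρ e) e =
      decide (Sum.inr ⟨e, he⟩ ∈ S) := by
  rw [flipTouch_of_notMem _ hnt]
  simp only [dif_pos he]

/-- The value of `φ S` on an edge touching a switched block (not a free edge): flipped. -/
lemma prod_eq_of_touches (S : Finset ({C // C ∈ 𝔉} ⊕ {e // e ∈ R})) {e : E} (he : e ∉ R)
    (ht : e ∈ touches (endsD ends d) {x : V | ∃ c : {C // C ∈ 𝔉}, Sum.inl c ∈ S ∧ x ∈ c.1}) :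
    flipTouch (endsD ends d) {x : V | ∃ c : {C // C ∈ 𝔉}, Sum.inl c ∈ S ∧ x ∈ c.1}
      (fun e => if h : e ∈ R then decide (Sum.inr ⟨e, h⟩ ∈ S) else ρ e) e = !ρ e := by
  rw [flipTouch_of_mem _ ht]
  simp only [dif_neg he]

/-- The value of `φ S` on a fixed edge (not free, not touching a switched block): as in `ρ`. -/
lemma prod_eq_fixed (S : Finset ({C // C ∈ 𝔉} ⊕ {e // e ∈ R})) {e : E} (he : e ∉ R)
    (hnt : e ∉ touches (endsD ends d) {x : V | ∃ c : {C // C ∈ 𝔉}, Sum.inl c ∈ S ∧ x ∈ c.1}) :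
    flipTouch (endsD ends d) {x : V | ∃ c : {C // C ∈ 𝔉}, Sum.inl c ∈ S ∧ x ∈ c.1}
      (fun e => if h : e ∈ R then decide (Sum.inr ⟨e, h⟩ ∈ S) else ρ e) e = ρ e := by
  rw [flipTouch_of_notMem _ hnt]
  simp only [dif_neg he]

/-- A free edge touches no switched block. -/
lemma notMem_touches_switched_of_mem_R (hdr : d ≠ r) (hds : d ≠ s)
    (hR : ∀ e, e ∈ R ↔ e ∉ touches ends (cluster ends ρ d ∪ K2 (endsD ends d) r s ρ ∪
      M2 (endsD ends d) r s ρ))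
    (h𝔉K : ∀ C ∈ 𝔉, (↑C : Set V) ⊆ K2 (endsD ends d) r s ρ)
    (S : Finset ({C // C ∈ 𝔉} ⊕ {e // e ∈ R})) {e : E} (he : e ∈ R) :
    e ∉ touches (endsD ends d) {x : V | ∃ c : {C // C ∈ 𝔉}, Sum.inl c ∈ S ∧ x ∈ c.1} := by
  rintro ⟨x, hx, y, hxy⟩
  have hxK : x ∈ K2 (endsD ends d) r s ρ := switched_subset_K2 h𝔉K S hx
  have hxd : x ≠ d := by rintro rfl; exact not_mem_K2_endsD hdr hds ρ hxK
  have hde : d ∉ ends e := by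
    intro hde
    rw [endsD_of_mem hde, Sym2.eq_iff] at hxy
    rcases hxy with ⟨h1, _⟩ | ⟨_, h1⟩ <;> exact hxd h1.symm
  rw [endsD_of_notMem hde] at hxy
  exact (hR e).1 he ⟨x, Or.inl (Or.inr hxK), y, hxy⟩

/-- The base point (the free edges of `S` open, the rest as in `ρ`) lies in the exploration
fibre of `ρ`. -/
lemma base_eqOn_U
    (hR : ∀ e, e ∈ R ↔ e ∉ touches ends (cluster ends ρ d ∪ K2 (endsD ends d) r s ρ ∪
      M2 (endsD ends d) r s ρ))
    (S : Finset ({C // C ∈ 𝔉} ⊕ {e // e ∈ R})) :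
    ∀ e ∈ touches ends (cluster ends ρ d ∪ K2 (endsD ends d) r s ρ ∪
      M2 (endsD ends d) r s ρ),
      (fun e => if h : e ∈ R then decide (Sum.inr ⟨e, h⟩ ∈ S) else ρ e) e = ρ e := by
  intro e he
  have : e ∉ R := fun h => (hR e).1 h he
  simp only [dif_neg this]

end EdgeValues

section Worlds

variable (hdr : d ≠ r) (hds : d ≠ s) (hrs : within ends ({r, s} : Set V) = ∅)
  (hT : ∀ e, ends e ≠ s(d, r) ∧ ends e ≠ s(d, s))
  (hsep : sep2 ends p q r s ρ) (hD : DOne ends r s d ρ) (hK : d ∈ K2 ends r s ρ)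
  (hB : ∀ x ∈ M2 (endsD ends d) r s ρ, x = r ∨ x = s)
  (hR : ∀ e, e ∈ R ↔ e ∉ touches ends (cluster ends ρ d ∪ K2 (endsD ends d) r s ρ ∪
    M2 (endsD ends d) r s ρ))
  (h𝔉K : ∀ C ∈ 𝔉, (↑C : Set V) ⊆ K2 (endsD ends d) r s ρ)
  (h𝔉r : ∀ C ∈ 𝔉, r ∉ C) (h𝔉s : ∀ C ∈ 𝔉, s ∉ C)
  (h𝔉cl : ∀ C ∈ 𝔉, ClosedIn (endsD ends d) (sided (endsD ends d) r s ρ) (↑C : Set V))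
  (h𝔉d : ∀ C ∈ 𝔉, ∀ e y, y ∈ C → ends e ≠ s(d, y))
  (h𝔉pk : ∀ C ∈ 𝔉, ∀ e x y, ends e = s(x, y) → x ∈ C → y ∈ cluster ends ρ d →
    y ∈ C ∨ y = r ∨ y = s)
  (S : Finset ({C // C ∈ 𝔉} ⊕ {e // e ∈ R}))

include hdr hds hrs hT hsep hB hR h𝔉K h𝔉r h𝔉s h𝔉cl in
/-- **The `Y`-world of `G − d` at `φ S`**: the `Y`-world of `ρ` without the switched vertices. -/
lemma K2_endsD_prod :
    K2 (endsD ends d) r s (flipTouch (endsD ends d)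
      {x : V | ∃ c : {C // C ∈ 𝔉}, Sum.inl c ∈ S ∧ x ∈ c.1}
      (fun e => if h : e ∈ R then decide (Sum.inr ⟨e, h⟩ ∈ S) else ρ e)) =
      K2 (endsD ends d) r s ρ \ {x : V | ∃ c : {C // C ∈ 𝔉}, Sum.inl c ∈ S ∧ x ∈ c.1} := by
  have hbase := base_eqOn_U (ρ := ρ) (r := r) (s := s) (d := d) hR S
  have hsep₀ := (sep2_iff_on_unitFibre hdr hds hrs hT hB hbase).2 hsep
  have hK₀ := K2_endsD_eq_on_unitFibre hdr hds hbase
  have hM₀ := M2_endsD_eq_on_unitFibre hdr hds hbase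
  have hsid : sided (endsD ends d) r s
      (fun e => if h : e ∈ R then decide (Sum.inr ⟨e, h⟩ ∈ S) else ρ e) =
      sided (endsD ends d) r s ρ := by
    ext x; simp only [sided, Set.mem_setOf_eq, hK₀, hM₀]
  have hC := switched_subset_K2 (ρ := ρ) (r := r) (s := s) (d := d) (R := R) h𝔉K S
  have hCr : r ∉ {x : V | ∃ c : {C // C ∈ 𝔉}, Sum.inl c ∈ S ∧ x ∈ c.1} := by
    rintro ⟨c, _, hr⟩; exact h𝔉r c.1 c.2 hr
  have hCs : s ∉ {x : V | ∃ c : {C // C ∈ 𝔉}, Sum.inl c ∈ S ∧ x ∈ c.1} := by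
    rintro ⟨c, _, hs⟩; exact h𝔉s c.1 c.2 hs
  rw [K2_flipTouch_of_closed (sep2_endsD_of_sep2 hsep₀)
    (fun x hx => by rw [hK₀]; exact Or.inl (hC hx)) hCr hCs
    (by rw [hsid]; exact closedIn_switched h𝔉cl S), hK₀, hM₀]
  ext x
  simp only [Set.mem_union, Set.mem_sdiff, Set.mem_inter_iff]
  constructor
  · rintro (h | ⟨hx, hxM⟩)
    · exact h
    · exfalso
      rcases hB x hxM with rfl | rfl
      · exact hCr hx
      · exact hCs hx
  · exact fun h => Or.inl h

include hdr hds hrs hT hsep hB hR h𝔉K h𝔉r h𝔉s h𝔉cl in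
/-- **The `W`-world of `G − d` at `φ S`**: `{r, s}` together with the switched vertices. -/
lemma M2_endsD_prod :
    M2 (endsD ends d) r s (flipTouch (endsD ends d)
      {x : V | ∃ c : {C // C ∈ 𝔉}, Sum.inl c ∈ S ∧ x ∈ c.1}
      (fun e => if h : e ∈ R then decide (Sum.inr ⟨e, h⟩ ∈ S) else ρ e)) =
      M2 (endsD ends d) r s ρ ∪ {x : V | ∃ c : {C // C ∈ 𝔉}, Sum.inl c ∈ S ∧ x ∈ c.1} := by
  have hbase := base_eqOn_U (ρ := ρ) (r := r) (s := s) (d := d) hR S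
  have hsep₀ := (sep2_iff_on_unitFibre hdr hds hrs hT hB hbase).2 hsep
  have hK₀ := K2_endsD_eq_on_unitFibre hdr hds hbase
  have hM₀ := M2_endsD_eq_on_unitFibre hdr hds hbase
  have hsid : sided (endsD ends d) r s
      (fun e => if h : e ∈ R then decide (Sum.inr ⟨e, h⟩ ∈ S) else ρ e) =
      sided (endsD ends d) r s ρ := by
    ext x; simp only [sided, Set.mem_setOf_eq, hK₀, hM₀]
  have hC := switched_subset_K2 (ρ := ρ) (r := r) (s := s) (d := d) (R := R) h𝔉K S
  have hCr : r ∉ {x : V | ∃ c : {C // C ∈ 𝔉}, Sum.inl c ∈ S ∧ x ∈ c.1} := by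
    rintro ⟨c, _, hr⟩; exact h𝔉r c.1 c.2 hr
  have hCs : s ∉ {x : V | ∃ c : {C // C ∈ 𝔉}, Sum.inl c ∈ S ∧ x ∈ c.1} := by
    rintro ⟨c, _, hs⟩; exact h𝔉s c.1 c.2 hs
  rw [M2_flipTouch_of_closed (sep2_endsD_of_sep2 hsep₀)
    (fun x hx => by rw [hK₀]; exact Or.inl (hC hx)) hCr hCs
    (by rw [hsid]; exact closedIn_switched h𝔉cl S), hK₀, hM₀]
  ext x
  simp only [Set.mem_union, Set.mem_sdiff, Set.mem_inter_iff]
  constructor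
  · rintro (⟨h, _⟩ | ⟨h, _⟩)
    · exact Or.inl h
    · exact Or.inr h
  · rintro (h | h)
    · exact Or.inl ⟨h, fun hx => by
        rcases hB x h with rfl | rfl
        · exact hCr hx
        · exact hCs hx⟩
    · exact Or.inr ⟨h, hC h⟩

end Worlds

end NoPocket

end Summit.Ventures.PercRepro2
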